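import Literature.Probability.Percolation.BoxCrossingUpperBound
import Literature.Probability.Percolation.Z2HalfPlaneThreeArm

/-!
# Stub `stub_boundaryArmTightness`, lattice input I: sector paths from the four long-way crossings
# (line `excursion-kernel-covariance`, crux `RectilinearCardy`, stmt-CriticalPhenomena-5660)

Deterministic lattice constructions in STANDARD orientation. Around a site `c` of `ℤ²` at scale
`l` we are given open long-way crossings of (some of) the four boxes of the square annulus
`c + A(l)` (top `[-3l, 3l] × [l + 1, 3l]`, bottom, left `[-3l, -l - 1] × [-3l, 3l]`, right; relative
coordinates), and integer thresholds `x₀, y₀, x₁` within `2` of `0` (the lattice lines just inside a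
wedge with apex near `c`). We build an open lattice walk staying in the corresponding lattice
sector and in the box `c + [-3l, 3l]²`, from the first lattice row above the START RAY (the
positive `x`-axis: a vertex with `w₁ = y₀`, `w₀ ≥ l`) to the first lattice line inside the sector
along the END RAY, passing through a HUB vertex deep inside the sector:

* `exists_sectorWalk_one` — quadrant `{w₀ ≥ x₀, w₁ ≥ y₀}` (end ray: positive `y`-axis; end
  vertex `w₀ = x₀`, `w₁ ≥ l`): the top and right crossings meet (`exists_mem_support_of_crossing`),
  and from the meeting vertex we follow each until it first leaves the quadrant
  (`exists_prefix_exit`);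
* `exists_sectorWalk_two` — half-plane `{w₁ ≥ y₀}` (end ray: negative `x`-axis; end vertex
  `w₁ = y₀`, `w₀ ≤ -l`): top crossing between its meetings with the left and right crossings, then
  down along those;
* `exists_sectorWalk_three` — three quadrants `{w₁ ≥ y₀} ∪ {w₀ ≤ x₁}` (end ray: negative `y`-axis;
  end vertex `w₀ = x₁`, `w₁ ≤ -l`): right crossing up to the top one, top, left down to the bottom
  one, bottom crossing rightwards until it first reaches the line `w₀ = x₁ + 1`.
-/

noncomputable section

open Set Filter Topology MeasureTheory
open Literature.Probability.Percolation
open Literature.Probability.LatticeModels (Site zdGraph)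

namespace Summit.CriticalPhenomena.CardyFormulaZ2.Cruxes.RectilinearCardy.ExcursionKernelCovariance

/-- **Following a crossing until it first leaves a half-plane `{w · e ≥ k}`.** From a vertex `s`
of a lattice walk `P` whose coordinate `i` is `≥ k` to an end whose coordinate `i` is `< k`, the
walk has an initial piece from `s`, inside `{z i ≥ k}`, ending at a vertex with coordinate
exactly `k`; it uses only vertices and edges of `P`. [folklore] -/
theorem exists_walk_to_level {a b s : Site 2} (P : (zdGraph 2).Walk a b) (i : Fin 2) (k : ℤ)
    (hs : s ∈ P.support) (hks : k ≤ s i) (hend : b i < k ∨ a i < k) :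
    ∃ (x : Site 2) (q : (zdGraph 2).Walk s x), x i = k ∧ x ∈ P.support ∧
      (∀ v ∈ q.support, k ≤ v i) ∧ (∀ v ∈ q.support, v ∈ P.support) ∧
      ∀ e ∈ q.edges, e ∈ P.edges := by
  classical
  -- the walk from `s` to the low end, using only `P`
  obtain ⟨t, Q, hQt, hQs, hQe⟩ : ∃ (t : Site 2) (Q : (zdGraph 2).Walk s t), t i < k ∧
      (∀ v ∈ Q.support, v ∈ P.support) ∧ ∀ e ∈ Q.edges, e ∈ P.edges := by
    rcases hend with hb | ha
    · exact ⟨b, P.dropUntil s hs, hb, fun v hv => P.support_dropUntil_subset_support hs hv,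
        fun e he => P.edges_dropUntil_subset_edges hs he⟩
    · exact ⟨a, (P.takeUntil s hs).reverse, ha,
        fun v hv => P.support_takeUntil_subset_support hs (by simpa using hv),
        fun e he => P.edges_takeUntil_subset_edges hs (by simpa using he)⟩
  obtain ⟨x, z, q₁, hxz, hz, hqA, hqsupp, hqedges, -⟩ :=
    exists_prefix_exit (A := {v : Site 2 | k ≤ v i}) Q hks (by simpa using hQt)
  simp only [mem_setOf_eq, not_le] at hz hqA
  have hx : k ≤ x i := hqA x q₁.end_mem_support
  have hnear : x i ≤ z i + 1 ∧ z i ≤ x i + 1 := by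
    rcases (zdGraph_two_adj_iff x z).1 hxz with ⟨h0, h1⟩ | ⟨h0, h1⟩ | ⟨h1, h0⟩ | ⟨h1, h0⟩ <;>
      fin_cases i <;> simp <;> omega
  have hxk : x i = k := by omega
  exact ⟨x, q₁, hxk, hQs x (hqsupp x q₁.end_mem_support), hqA, fun v hv => hQs v (hqsupp v hv),
    fun e he => hQe e (hqedges e he)⟩

/-- Symmetric form of `exists_walk_to_level` for a half-plane `{z i ≤ k}`. [folklore] -/
theorem exists_walk_to_level' {a b s : Site 2} (P : (zdGraph 2).Walk a b) (i : Fin 2) (k : ℤ)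
    (hs : s ∈ P.support) (hks : s i ≤ k) (hend : k < b i ∨ k < a i) :
    ∃ (x : Site 2) (q : (zdGraph 2).Walk s x), x i = k ∧ x ∈ P.support ∧
      (∀ v ∈ q.support, v i ≤ k) ∧ (∀ v ∈ q.support, v ∈ P.support) ∧
      ∀ e ∈ q.edges, e ∈ P.edges := by
  classical
  obtain ⟨t, Q, hQt, hQs, hQe⟩ : ∃ (t : Site 2) (Q : (zdGraph 2).Walk s t), k < t i ∧
      (∀ v ∈ Q.support, v ∈ P.support) ∧ ∀ e ∈ Q.edges, e ∈ P.edges := by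
    rcases hend with hb | ha
    · exact ⟨b, P.dropUntil s hs, hb, fun v hv => P.support_dropUntil_subset_support hs hv,
        fun e he => P.edges_dropUntil_subset_edges hs he⟩
    · exact ⟨a, (P.takeUntil s hs).reverse, ha,
        fun v hv => P.support_takeUntil_subset_support hs (by simpa using hv),
        fun e he => P.edges_takeUntil_subset_edges hs (by simpa using he)⟩
  obtain ⟨x, z, q₁, hxz, hz, hqA, hqsupp, hqedges, -⟩ :=
    exists_prefix_exit (A := {v : Site 2 | v i ≤ k}) Q hks (by simpa using hQt)
  simp only [mem_setOf_eq, not_le] at hz hqA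
  have hx : x i ≤ k := hqA x q₁.end_mem_support
  have hnear : x i ≤ z i + 1 ∧ z i ≤ x i + 1 := by
    rcases (zdGraph_two_adj_iff x z).1 hxz with ⟨h0, h1⟩ | ⟨h0, h1⟩ | ⟨h1, h0⟩ | ⟨h1, h0⟩ <;>
      fin_cases i <;> simp <;> omega
  have hxk : x i = k := by omega
  exact ⟨x, q₁, hxk, hQs x (hqsupp x q₁.end_mem_support), hqA, fun v hv => hQs v (hqsupp v hv),
    fun e he => hQe e (hqedges e he)⟩

/-- **Sector walk, one quadrant.** From an open left-right crossing `T` of the top box and an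
open top-bottom crossing `R` of the right box of `c + A(l)` (`l ≥ 3`), and thresholds
`|x₀|, |y₀| ≤ 2`: an open lattice walk inside `{w₀ ≥ x₀, w₁ ≥ y₀} ∩ [-3l, 3l]²` (coordinates
relative to `c`) from a vertex with `w₁ = y₀`, `w₀ ≥ l` to a vertex with `w₀ = x₀`, `w₁ ≥ l`,
through a vertex with `w₀ ≥ l`, `w₁ ≥ l`. [folklore] -/
theorem exists_sectorWalk_one {ω : BondConfig (Site 2)} {c : Site 2} {l : ℕ} (hl : 3 ≤ l)
    {x₀ y₀ : ℤ} (hx₀ : |x₀| ≤ 2) (hy₀ : |y₀| ≤ 2)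
    {aT bT : Site 2} (T : (zdGraph 2).Walk aT bT) (haT : aT 0 = c 0 - 3 * l)
    (hbT : bT 0 = c 0 + 3 * l)
    (hTs : ∀ z ∈ T.support, c 0 - 3 * l ≤ z 0 ∧ z 0 ≤ c 0 + 3 * l ∧
      c 1 + l + 1 ≤ z 1 ∧ z 1 ≤ c 1 + 3 * l)
    (hTe : ∀ e ∈ T.edges, e ∈ ω)
    {aR bR : Site 2} (R : (zdGraph 2).Walk aR bR) (haR : aR 1 = c 1 - 3 * l)
    (hbR : bR 1 = c 1 + 3 * l)
    (hRs : ∀ z ∈ R.support, c 0 + l + 1 ≤ z 0 ∧ z 0 ≤ c 0 + 3 * l ∧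
      c 1 - 3 * l ≤ z 1 ∧ z 1 ≤ c 1 + 3 * l)
    (hRe : ∀ e ∈ R.edges, e ∈ ω) :
    ∃ (vE vX : Site 2) (W : (zdGraph 2).Walk vE vX), (∀ e ∈ W.edges, e ∈ ω) ∧
      (∀ z ∈ W.support, x₀ ≤ z 0 - c 0 ∧ y₀ ≤ z 1 - c 1 ∧ |z 0 - c 0| ≤ 3 * l ∧ |z 1 - c 1| ≤ 3 * l) ∧
      (vE 1 - c 1 = y₀ ∧ (l : ℤ) ≤ vE 0 - c 0) ∧ (vX 0 - c 0 = x₀ ∧ (l : ℤ) ≤ vX 1 - c 1) ∧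
      ∃ h ∈ W.support, (l : ℤ) ≤ h 0 - c 0 ∧ (l : ℤ) ≤ h 1 - c 1 := by
  classical
  have hl' : (3 : ℤ) ≤ l := by exact_mod_cast hl
  have hx₀' := abs_le.1 hx₀
  have hy₀' := abs_le.1 hy₀
  -- the meeting vertex of `T` and `R`
  have sqT : ∀ z ∈ T.support, c 0 - 3 * l ≤ z 0 ∧ z 0 ≤ c 0 + 3 * l ∧
      c 1 - 3 * l ≤ z 1 ∧ z 1 ≤ c 1 + 3 * l := fun z hz => by have := hTs z hz; omega
  have sqR : ∀ z ∈ R.support, c 0 - 3 * l ≤ z 0 ∧ z 0 ≤ c 0 + 3 * l ∧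
      c 1 - 3 * l ≤ z 1 ∧ z 1 ≤ c 1 + 3 * l := fun z hz => by have := hRs z hz; omega
  obtain ⟨m, hmT, hmR⟩ := exists_mem_support_of_crossing T R sqT sqR haT hbT haR hbR
  have hm0 := (hRs m hmR).1
  have hm1 := (hTs m hmT).2.2.1
  -- follow `T` from `m` leftwards to the line `w₀ = x₀`
  obtain ⟨vX, q₁, hvX, hvXT, hq₁A, hq₁s, hq₁e⟩ :=
    exists_walk_to_level T 0 (c 0 + x₀) hmT (by omega) (Or.inr (by rw [haT]; omega))
  -- follow `R` from `m` downwards to the line `w₁ = y₀`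
  obtain ⟨vE, q₂, hvE, hvER, hq₂A, hq₂s, hq₂e⟩ :=
    exists_walk_to_level R 1 (c 1 + y₀) hmR (by omega) (Or.inr (by rw [haR]; omega))
  refine ⟨vE, vX, q₂.reverse.append q₁, ?_, ?_, ⟨by omega, by have := hRs vE hvER; omega⟩,
    ⟨by omega, by have := hTs vX hvXT; omega⟩, m, ?_, by omega, by omega⟩
  · intro e he
    rw [SimpleGraph.Walk.edges_append, List.mem_append, SimpleGraph.Walk.edges_reverse,
      List.mem_reverse] at he
    rcases he with he | he
    · exact hRe e (hq₂e e he)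
    · exact hTe e (hq₁e e he)
  · intro z hz
    rw [SimpleGraph.Walk.mem_support_append_iff, SimpleGraph.Walk.support_reverse,
      List.mem_reverse] at hz
    rcases hz with hz | hz
    · have h1 := hq₂A z hz
      have h2 := hRs z (hq₂s z hz)
      refine ⟨by omega, by omega, abs_le.2 ⟨by omega, by omega⟩, abs_le.2 ⟨by omega, by omega⟩⟩
    · have h1 := hq₁A z hz
      have h2 := hTs z (hq₁s z hz)
      refine ⟨by omega, by omega, abs_le.2 ⟨by omega, by omega⟩, abs_le.2 ⟨by omega, by omega⟩⟩
  · rw [SimpleGraph.Walk.mem_support_append_iff]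
    exact Or.inr q₁.start_mem_support

/-- **Sector walk, two quadrants (half-plane).** From open long-way crossings `T` (top box),
`L` (left box), `R` (right box) of `c + A(l)` (`l ≥ 3`) and a threshold `|y₀| ≤ 2`: an open
lattice walk inside `{w₁ ≥ y₀} ∩ [-3l, 3l]²` from a vertex with `w₁ = y₀`, `w₀ ≥ l` to a vertex
with `w₁ = y₀`, `w₀ ≤ -l`, through a vertex with `w₁ ≥ l`. [folklore] -/
theorem exists_sectorWalk_two {ω : BondConfig (Site 2)} {c : Site 2} {l : ℕ} (hl : 3 ≤ l)
    {y₀ : ℤ} (hy₀ : |y₀| ≤ 2)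
    {aT bT : Site 2} (T : (zdGraph 2).Walk aT bT) (haT : aT 0 = c 0 - 3 * l)
    (hbT : bT 0 = c 0 + 3 * l)
    (hTs : ∀ z ∈ T.support, c 0 - 3 * l ≤ z 0 ∧ z 0 ≤ c 0 + 3 * l ∧
      c 1 + l + 1 ≤ z 1 ∧ z 1 ≤ c 1 + 3 * l)
    (hTe : ∀ e ∈ T.edges, e ∈ ω)
    {aL bL : Site 2} (L : (zdGraph 2).Walk aL bL) (haL : aL 1 = c 1 - 3 * l)
    (hbL : bL 1 = c 1 + 3 * l)
    (hLs : ∀ z ∈ L.support, c 0 - 3 * l ≤ z 0 ∧ z 0 ≤ c 0 - l - 1 ∧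
      c 1 - 3 * l ≤ z 1 ∧ z 1 ≤ c 1 + 3 * l)
    (hLe : ∀ e ∈ L.edges, e ∈ ω)
    {aR bR : Site 2} (R : (zdGraph 2).Walk aR bR) (haR : aR 1 = c 1 - 3 * l)
    (hbR : bR 1 = c 1 + 3 * l)
    (hRs : ∀ z ∈ R.support, c 0 + l + 1 ≤ z 0 ∧ z 0 ≤ c 0 + 3 * l ∧
      c 1 - 3 * l ≤ z 1 ∧ z 1 ≤ c 1 + 3 * l)
    (hRe : ∀ e ∈ R.edges, e ∈ ω) :
    ∃ (vE vX : Site 2) (W : (zdGraph 2).Walk vE vX), (∀ e ∈ W.edges, e ∈ ω) ∧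
      (∀ z ∈ W.support, y₀ ≤ z 1 - c 1 ∧ |z 0 - c 0| ≤ 3 * l ∧ |z 1 - c 1| ≤ 3 * l) ∧
      (vE 1 - c 1 = y₀ ∧ (l : ℤ) ≤ vE 0 - c 0) ∧ (vX 1 - c 1 = y₀ ∧ vX 0 - c 0 ≤ -(l : ℤ)) ∧
      ∃ h ∈ W.support, (l : ℤ) ≤ h 1 - c 1 := by
  classical
  have hl' : (3 : ℤ) ≤ l := by exact_mod_cast hl
  have hy₀' := abs_le.1 hy₀
  have sqT : ∀ z ∈ T.support, c 0 - 3 * l ≤ z 0 ∧ z 0 ≤ c 0 + 3 * l ∧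
      c 1 - 3 * l ≤ z 1 ∧ z 1 ≤ c 1 + 3 * l := fun z hz => by have := hTs z hz; omega
  have sqL : ∀ z ∈ L.support, c 0 - 3 * l ≤ z 0 ∧ z 0 ≤ c 0 + 3 * l ∧
      c 1 - 3 * l ≤ z 1 ∧ z 1 ≤ c 1 + 3 * l := fun z hz => by have := hLs z hz; omega
  have sqR : ∀ z ∈ R.support, c 0 - 3 * l ≤ z 0 ∧ z 0 ≤ c 0 + 3 * l ∧
      c 1 - 3 * l ≤ z 1 ∧ z 1 ≤ c 1 + 3 * l := fun z hz => by have := hRs z hz; omega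
  obtain ⟨mL, hmLT, hmLL⟩ := exists_mem_support_of_crossing T L sqT sqL haT hbT haL hbL
  obtain ⟨mR, hmRT, hmRR⟩ := exists_mem_support_of_crossing T R sqT sqR haT hbT haR hbR
  -- the top piece from `mR` to `mL`
  obtain ⟨qT, hqTe, hqTs⟩ := exists_subwalk T hmRT hmLT
  -- down along `R` from `mR` and along `L` from `mL`
  obtain ⟨vE, qR, hvE, hvER, hqRA, hqRs, hqRe⟩ :=
    exists_walk_to_level R 1 (c 1 + y₀) hmRR (by have := hTs mR hmRT; omega)
      (Or.inr (by rw [haR]; omega))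
  obtain ⟨vX, qL, hvX, hvXL, hqLA, hqLs, hqLe⟩ :=
    exists_walk_to_level L 1 (c 1 + y₀) hmLL (by have := hTs mL hmLT; omega)
      (Or.inr (by rw [haL]; omega))
  refine ⟨vE, vX, qR.reverse.append (qT.append qL), ?_, ?_,
    ⟨by omega, by have := hRs vE hvER; omega⟩, ⟨by omega, by have := hLs vX hvXL; omega⟩,
    mR, ?_, by have := hTs mR hmRT; omega⟩
  · intro e he
    simp only [SimpleGraph.Walk.edges_append, List.mem_append, SimpleGraph.Walk.edges_reverse,
      List.mem_reverse] at he
    rcases he with he | he | he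
    · exact hRe e (hqRe e he)
    · exact hTe e (hqTe e he)
    · exact hLe e (hqLe e he)
  · intro z hz
    simp only [SimpleGraph.Walk.mem_support_append_iff, SimpleGraph.Walk.support_reverse,
      List.mem_reverse] at hz
    rcases hz with hz | hz | hz
    · have h1 := hqRA z hz
      have h2 := hRs z (hqRs z hz)
      exact ⟨by omega, abs_le.2 ⟨by omega, by omega⟩, abs_le.2 ⟨by omega, by omega⟩⟩
    · have h2 := hTs z (hqTs z hz)
      exact ⟨by omega, abs_le.2 ⟨by omega, by omega⟩, abs_le.2 ⟨by omega, by omega⟩⟩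
    · have h1 := hqLA z hz
      have h2 := hLs z (hqLs z hz)
      exact ⟨by omega, abs_le.2 ⟨by omega, by omega⟩, abs_le.2 ⟨by omega, by omega⟩⟩
  · rw [SimpleGraph.Walk.mem_support_append_iff, SimpleGraph.Walk.support_reverse,
      List.mem_reverse]
    exact Or.inl qR.start_mem_support

/-- **Sector walk, three quadrants.** From open long-way crossings `T`, `B`, `L`, `R` of the four
boxes of `c + A(l)` (`l ≥ 3`) and thresholds `|x₁|, |y₀| ≤ 2`: an open lattice walk inside
`({w₁ ≥ y₀} ∪ {w₀ ≤ x₁}) ∩ [-3l, 3l]²` from a vertex with `w₁ = y₀`, `w₀ ≥ l` to a vertex with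
`w₀ = x₁`, `w₁ ≤ -l`, through a vertex with `w₁ ≥ l`. [folklore] -/
theorem exists_sectorWalk_three {ω : BondConfig (Site 2)} {c : Site 2} {l : ℕ} (hl : 3 ≤ l)
    {x₁ y₀ : ℤ} (hx₁ : |x₁| ≤ 2) (hy₀ : |y₀| ≤ 2)
    {aT bT : Site 2} (T : (zdGraph 2).Walk aT bT) (haT : aT 0 = c 0 - 3 * l)
    (hbT : bT 0 = c 0 + 3 * l)
    (hTs : ∀ z ∈ T.support, c 0 - 3 * l ≤ z 0 ∧ z 0 ≤ c 0 + 3 * l ∧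
      c 1 + l + 1 ≤ z 1 ∧ z 1 ≤ c 1 + 3 * l)
    (hTe : ∀ e ∈ T.edges, e ∈ ω)
    {aB bB : Site 2} (B : (zdGraph 2).Walk aB bB) (haB : aB 0 = c 0 - 3 * l)
    (hbB : bB 0 = c 0 + 3 * l)
    (hBs : ∀ z ∈ B.support, c 0 - 3 * l ≤ z 0 ∧ z 0 ≤ c 0 + 3 * l ∧
      c 1 - 3 * l ≤ z 1 ∧ z 1 ≤ c 1 - l - 1)
    (hBe : ∀ e ∈ B.edges, e ∈ ω)
    {aL bL : Site 2} (L : (zdGraph 2).Walk aL bL) (haL : aL 1 = c 1 - 3 * l)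
    (hbL : bL 1 = c 1 + 3 * l)
    (hLs : ∀ z ∈ L.support, c 0 - 3 * l ≤ z 0 ∧ z 0 ≤ c 0 - l - 1 ∧
      c 1 - 3 * l ≤ z 1 ∧ z 1 ≤ c 1 + 3 * l)
    (hLe : ∀ e ∈ L.edges, e ∈ ω)
    {aR bR : Site 2} (R : (zdGraph 2).Walk aR bR) (haR : aR 1 = c 1 - 3 * l)
    (hbR : bR 1 = c 1 + 3 * l)
    (hRs : ∀ z ∈ R.support, c 0 + l + 1 ≤ z 0 ∧ z 0 ≤ c 0 + 3 * l ∧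
      c 1 - 3 * l ≤ z 1 ∧ z 1 ≤ c 1 + 3 * l)
    (hRe : ∀ e ∈ R.edges, e ∈ ω) :
    ∃ (vE vX : Site 2) (W : (zdGraph 2).Walk vE vX), (∀ e ∈ W.edges, e ∈ ω) ∧
      (∀ z ∈ W.support, (y₀ ≤ z 1 - c 1 ∨ z 0 - c 0 ≤ x₁) ∧ |z 0 - c 0| ≤ 3 * l ∧
        |z 1 - c 1| ≤ 3 * l) ∧
      (vE 1 - c 1 = y₀ ∧ (l : ℤ) ≤ vE 0 - c 0) ∧ (vX 0 - c 0 = x₁ ∧ vX 1 - c 1 ≤ -(l : ℤ)) ∧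
      ∃ h ∈ W.support, (l : ℤ) ≤ h 1 - c 1 := by
  classical
  have hl' : (3 : ℤ) ≤ l := by exact_mod_cast hl
  have hx₁' := abs_le.1 hx₁
  have hy₀' := abs_le.1 hy₀
  have sqT : ∀ z ∈ T.support, c 0 - 3 * l ≤ z 0 ∧ z 0 ≤ c 0 + 3 * l ∧
      c 1 - 3 * l ≤ z 1 ∧ z 1 ≤ c 1 + 3 * l := fun z hz => by have := hTs z hz; omega
  have sqB : ∀ z ∈ B.support, c 0 - 3 * l ≤ z 0 ∧ z 0 ≤ c 0 + 3 * l ∧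
      c 1 - 3 * l ≤ z 1 ∧ z 1 ≤ c 1 + 3 * l := fun z hz => by have := hBs z hz; omega
  have sqL : ∀ z ∈ L.support, c 0 - 3 * l ≤ z 0 ∧ z 0 ≤ c 0 + 3 * l ∧
      c 1 - 3 * l ≤ z 1 ∧ z 1 ≤ c 1 + 3 * l := fun z hz => by have := hLs z hz; omega
  have sqR : ∀ z ∈ R.support, c 0 - 3 * l ≤ z 0 ∧ z 0 ≤ c 0 + 3 * l ∧
      c 1 - 3 * l ≤ z 1 ∧ z 1 ≤ c 1 + 3 * l := fun z hz => by have := hRs z hz; omega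
  obtain ⟨mTL, hmTL_T, hmTL_L⟩ := exists_mem_support_of_crossing T L sqT sqL haT hbT haL hbL
  obtain ⟨mTR, hmTR_T, hmTR_R⟩ := exists_mem_support_of_crossing T R sqT sqR haT hbT haR hbR
  obtain ⟨mBL, hmBL_B, hmBL_L⟩ := exists_mem_support_of_crossing B L sqB sqL haB hbB haL hbL
  -- the pieces
  obtain ⟨qT, hqTe, hqTs⟩ := exists_subwalk T hmTR_T hmTL_T
  obtain ⟨qL, hqLe, hqLs⟩ := exists_subwalk L hmTL_L hmBL_L
  obtain ⟨vE, qR, hvE, hvER, hqRA, hqRs, hqRe⟩ :=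
    exists_walk_to_level R 1 (c 1 + y₀) hmTR_R (by have := hTs mTR hmTR_T; omega)
      (Or.inr (by rw [haR]; omega))
  obtain ⟨vX, qB, hvX, hvXB, hqBA, hqBs, hqBe⟩ :=
    exists_walk_to_level' B 0 (c 0 + x₁) hmBL_B (by have := hLs mBL hmBL_L; omega)
      (Or.inl (by rw [hbB]; omega))
  refine ⟨vE, vX, qR.reverse.append (qT.append (qL.append qB)), ?_, ?_,
    ⟨by omega, by have := hRs vE hvER; omega⟩, ⟨by omega, by have := hBs vX hvXB; omega⟩,
    mTR, ?_, by have := hTs mTR hmTR_T; omega⟩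
  · intro e he
    simp only [SimpleGraph.Walk.edges_append, List.mem_append, SimpleGraph.Walk.edges_reverse,
      List.mem_reverse] at he
    rcases he with he | he | he | he
    · exact hRe e (hqRe e he)
    · exact hTe e (hqTe e he)
    · exact hLe e (hqLe e he)
    · exact hBe e (hqBe e he)
  · intro z hz
    simp only [SimpleGraph.Walk.mem_support_append_iff, SimpleGraph.Walk.support_reverse,
      List.mem_reverse] at hz
    rcases hz with hz | hz | hz | hz
    · have h1 := hqRA z hz
      have h2 := hRs z (hqRs z hz)
      exact ⟨Or.inl (by omega), abs_le.2 ⟨by omega, by omega⟩, abs_le.2 ⟨by omega, by omega⟩⟩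
    · have h2 := hTs z (hqTs z hz)
      exact ⟨Or.inl (by omega), abs_le.2 ⟨by omega, by omega⟩, abs_le.2 ⟨by omega, by omega⟩⟩
    · have h2 := hLs z (hqLs z hz)
      exact ⟨Or.inr (by omega), abs_le.2 ⟨by omega, by omega⟩, abs_le.2 ⟨by omega, by omega⟩⟩
    · have h1 := hqBA z hz
      have h2 := hBs z (hqBs z hz)
      exact ⟨Or.inr (by omega), abs_le.2 ⟨by omega, by omega⟩, abs_le.2 ⟨by omega, by omega⟩⟩
  · rw [SimpleGraph.Walk.mem_support_append_iff, SimpleGraph.Walk.support_reverse,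
      List.mem_reverse]
    exact Or.inl qR.start_mem_support

end Summit.CriticalPhenomena.CardyFormulaZ2.Cruxes.RectilinearCardy.ExcursionKernelCovariance

end
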